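import Summits.QuantumFields.YangMills.Theorems.TwistedTraceScaling.Negative.AvgKernelNoLabSlowFactor
import Summits.QuantumFields.YangMills.Theorems.LuscherReductionTwistedTraceScalingOrthoTransverseRotation
import Summits.QuantumFields.YangMills.Theorems.LuscherReductionTwistedTraceScalingToronCurl
import Summits.QuantumFields.YangMills.Theorems.LuscherReductionTwistedTraceScalingValleyGeomOfLinkProx
import HarnessLib

/-!
# R33 — the STIFF FLIP: over abelian slow data the gauge-averaged kernel `K̃_β = avgKernel β` is blind to the sign of transverse stiff data, while the LAB
# kernel pays `e^{−4βΣ_e|v_e|²}` exactly (crux disprover of `TwistedTraceScaling`, stmt-QuantumFields-20203, cycle 26; `--supports` the crux; negative lane, def-free)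

Lane A's C4-CORE architecture of record (`pub/ym-fleet/ym-luscher-20007-p1/COARSE-DESIGN.md` §23.2 (3), §23.5 (d), §23.7; HANDOFF-g12) displays the POINTWISE model
`K̃_β(Ψ(u,w,η), Ψ(u',w',η')) = 𝒩_g · K₁^{L³β|m||m'|}(u,u') · G_st(w,w') · 1(η,η') · (1 ± η_K)` on the tube `T × T`, `G_st` «the c-FROZEN two-slice stiff Gaussian» in the
LAB-aligned stiff coordinate `w = R_u v` (§23.7) — an UNTWISTED product of a slow factor and a stiff factor.  R32/R32b (`…Negative.AvgKernelNoLabSlowFactor(Kinetic)`) showed that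
the slow factor cannot be the LAB kernel `K₁^{L³β}(u,u')` (`K̃_β` is separately `Ad`-invariant in the slow pair) and offered the `Ad`-averaged one-site kernel `k̃(u,u')` as the cheap
repair.  THIS FILE (identities + the witness) and its sequel R33b (`…Negative.AvgKernelNoUntwistedStiffFactor`, the no-go theorems) show that the STIFF factor must be twisted
TOGETHER with the slow one.  The tube `T ∋ orthoTube u v` is stable under the CONSTANT gauge group (§23.2 (3): `{g : U^g ∈ T} = SU(2)_const · {…}`); `K̃_β` is constant along
its orbits `(u, v) ↦ (Ad_g u, Ad(g) v)` in EACH slot separately (§1, bi-invariance); and at ABELIAN slow data `u_θ = (diagSU2 θ_k)_k` the stabiliser `{diagSU2 φ}` moves the stiff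
datum ALONE — the half-turn `diagSU2 (π/2)` fixes `u_θ` and flips every transverse stiff datum, `v ↦ −v` (§2–§3); at the vacuum slow datum `u = 1` all of `SU(2)_const` does (§3).

* §1 `gaugeTransform_const_orthoTube` — `(orthoTube u v)^{g} = orthoTube (Ad_g u) (Ad(g) v)` for a constant `g` (on the cap).
* §2 `gaugeTransform_const_diag`, `adRot_halfTurn_mulVec_of_transverse`, `colourRotate_halfTurn_of_transverse` — diagonal constants fix abelian diagonal slow data;
  `Ad(diagSU2 (π/2)) = diag(1,−1,−1)` flips transverse stiff data.
* §3 ★ `gaugeTransform_halfTurn_orthoTube` — `(orthoTube u_θ v)^{diagSU2 (π/2)} = orthoTube u_θ (−v)`; ★ `avgKernel_orthoTube_diag_neg_right/left` — `K̃_β(U, orthoTube u_θ (−v))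
  = K̃_β(U, orthoTube u_θ v)` (and in the left slot); ★ `avgKernel_orthoTube_one_colourRotate` — `K̃_β(U, orthoTube 1 (Ad(g) v)) = K̃_β(U, orthoTube 1 v)` for every `g ∈ SU(2)`.
* §4 ★ `transferKernel_orthoTube_diag_neg` — the LAB kernel across the flip, EXACTLY: `K_β(orthoTube u_θ v, orthoTube u_θ (−v)) = e^{−4βΣ_e|v_e|²}·K_β(orthoTube u_θ v, orthoTube u_θ v)`
  (`timeCoupling_orthoTube_neg`: `Σ_e Re tr((P(v_e)u_k)(P(−v_e)u_k)⁻¹) = Σ_e(2 − 4|v_e|²)` for ANY slow datum `u`; the Wilson actions agree by gauge invariance).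
* §5 `frobNorm_orthoTube_sub_one_le`, `orbitDist_orthoTube_le` (tube points near the vacuum); `exists_stiff_witness` — the antipodal two-link transverse stiff datum `v^{(a)}`
  (`v_{(0,0)} = a·e₁`, `v_{(x₁,0)} = −a·e₁`, `x₁ = (1,1,1) ≠ 0`, needs `2 ≤ L`): capped, balanced, `Σ_e|v_e|² = 2a²`, `Σ_e|v_e| = 2a`; ★★ `exists_stiff_flip_pair` — for `2 ≤ L`,
  `s ≥ 0`, EVERY `β` and EVERY amplitude `0 < a ≤ β^{−s}/16`: the pair `U = orthoTube u_θ v^{(a)}`, `V = orthoTube u_θ (−v^{(a)})`, `θ = β^{−s}/(8|E|)`, lies in the C4-CORE (slow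
  datum, every link and `orbitDist` of BOTH points `< β^{−s} = powScale s β`), `V = U^{g}` with `g` constant, `K̃_β(U,V) = K̃_β(U,U)` and `K_β(U,V) = e^{−8βa²}·K_β(U,U)`.

READING.  Along the `SU(2)_const`-orbits inside `T` the averaged kernel is FLAT while any untwisted product `F(u,u')·G_st(w,w')` with a kinetic stiff term `β|w − w'|²` is not:
at the flip pair the product drops by `e^{−(4+o(1))β·Σ|v_e|²}` — a FIXED factor `e^{−2C²}` for kinetic-typical stiff size `Σ|v_e|² = C²/(2β)`, and `→ 0` for stiff size `β^{−2s}/128`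
(still inside the core and the cap).  The pointwise model of `K̃_β` on `T × T` that survives is the TWISTED product `∫_{SU(2)} K₁^{L³β}(u, Ad_g u')·G_st(w, R_g w') dg` (invariant under
the constant group in each slot, as `K̃_β` is); it collapses to «slow factor × stiff factor» `(1 ± o(1))` only where the one-site kinetic term `L³β|u − Ad_g u'|²` localises `g` modulo
the STABILISER of the slow data, i.e. OFF a neighbourhood of the abelian slow locus `A` (5-dimensional, through the vacuum, codimension 4 in `SU(2)³`); heuristically (for lane A to
certify at the OPERATOR level in (4)/(g), not pointwise): width `≍ β^{−1/2}` in one-site distance for kinetic-typical stiff data, relative one-site Haar measure `≍ β^{4s−2}` of the core.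
R32's repair (`k̃` for `K₁`) is the `u`-marginal of this statement; near `A` the stiff fibre does not decouple from the residual global colour rotation.  The mechanism of §23 (exact
one-site Haar in `u`, FP slice for the non-constant gauge modes, Laplace in `w`) is untouched; the displayed identity (3)/(d) is misstated on `A`'s neighbourhood.
HONEST FRAMING: finite-dimensional identities about one displayed intermediate formula of lane A's design for stub S-BASE/C4-CORE of a child of the CONDITIONAL reduction route
R2b1 (`LuscherReduction`); it does not refute `TwistedTraceScaling`, C4, or any registered statement; not a gap, not Clay.

## References
* M. Lüscher, Some analytic results concerning the mass spectrum of Yang–Mills gauge theories on a torus, Nucl. Phys. B219 (1983) 233–261, §3 (constant modes, the residual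
  global gauge group acts on the effective problem). [Luscher1983]
* E. Seiler, Gauge Theories as a Problem of Constructive Quantum Field Theory and Statistical Mechanics, LNP 159 (1982), §3 (transfer matrix; Gauss law by averaging over ALL gauge
  transformations, constants included). [SeilerLNP1982]
* T. Bröcker, T. tom Dieck, Representations of Compact Lie Groups, GTM 98 (1985), I (1.10) (`Ad : SU(2) → SO(3)`, maximal torus and its stabiliser). [BrockerTomDieck1985]
-/

set_option autoImplicit false

noncomputable section

open Real Filter Topology
open Literature.MathematicalPhysics.QuantumFieldTheory hiding SU2
open Literature.MathematicalPhysics.QuantumLattice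

namespace Summit.QuantumFields.YangMills.Theorems.TwistedTraceScaling.Negative.R33

open Summit.QuantumFields.YangMills.Theorems.FemtoTransferGap
open Summit.QuantumFields.YangMills.Theorems.FemtoTransferGap.TwoLattice.Toron (coe_diagSU2 diagSU2_add diagSU2_neg diagSU2_zero
  frobNorm_diagSU2_sub_one_le adRot_diagSU2 chargedRot)
open Summit.QuantumFields.YangMills.Theorems.FemtoTransferGap.TwoLattice.Avg
open Summit.QuantumFields.YangMills.Theorems.FemtoTransferGap.TwoLattice.ConstTube
open Summit.QuantumFields.YangMills.Theorems.FemtoTransferGap.TwoLattice.Cov (scalarPart_inv vecPart_inv)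
open Summit.QuantumFields.YangMills.Theorems.TwistedTraceScaling.Negative.R32 (timeCoupling_self su2Rep_apply)

variable {L : ℕ} [NeZero L]

/-! ## §1 Constant gauge transformations act on tube points slot-wise -/

omit [NeZero L] in
/-- A CONSTANT gauge transformation `g` of the torus maps the tube point `orthoTube u v` to the tube point with conjugated slow datum `Ad_g u` and
colour-rotated stiff datum `Ad(g) v` (on the cap). [cite: BrockerTomDieck1985, I (1.10)] -/
theorem gaugeTransform_const_orthoTube (g : SU2) (u : GaugeConfig 3 1 SU2) {v : Edge 3 L → Fin 3 → ℝ} (hv : ∀ e : Edge 3 L, ∑ a, v e a ^ 2 ≤ 1) :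
    gaugeTransform (fun _ : Site 3 L => g) (orthoTube L u v) =
      orthoTube L (gaugeTransform (fun _ : Site 3 1 => g) u) (colourRotate L (fun _ => g) v) := by
  funext e
  show g * (chartSU2 (v e) * u (0, e.2)) * g⁻¹ = chartSU2 ((adRot g).mulVec (v e)) * (g * u (0, e.2) * g⁻¹)
  rw [chartSU2_adRot g (hv e)]
  group

/-! ## §2 Abelian diagonal slow data are fixed, transverse stiff data are flipped, by the constant half-turn `diagSU2 (π/2)` -/

omit [NeZero L] in
/-- Diagonal elements commute: `diagSU2 φ · diagSU2 θ · (diagSU2 φ)⁻¹ = diagSU2 θ`. [folklore] -/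
theorem diagSU2_conj_diagSU2 (φ θ : ℝ) : diagSU2 φ * diagSU2 θ * (diagSU2 φ)⁻¹ = diagSU2 θ := by
  rw [← diagSU2_add, ← diagSU2_neg, ← diagSU2_add]
  congr 1
  ring

omit [NeZero L] in
/-- A constant diagonal gauge transformation fixes every abelian diagonal one-site datum `u_θ = (diagSU2 θ₀, diagSU2 θ₁, diagSU2 θ₂)`: the constant-gauge
STABILISER of abelian slow data contains the maximal torus. [folklore] -/
theorem gaugeTransform_const_diag (φ : ℝ) (θ : Fin 3 → ℝ) :
    gaugeTransform (fun _ : Site 3 1 => diagSU2 φ) (fun e : Edge 3 1 => diagSU2 (θ e.2)) = fun e : Edge 3 1 => diagSU2 (θ e.2) := by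
  funext e
  exact diagSU2_conj_diagSU2 φ (θ e.2)

omit [NeZero L] in
/-- `Ad(diagSU2 (π/2)) = diag(1, −1, −1)` flips every vector transverse to the torus axis. [cite: BrockerTomDieck1985, I (1.10)] -/
theorem adRot_halfTurn_mulVec_of_transverse {x : Fin 3 → ℝ} (hx : x 0 = 0) : (adRot (diagSU2 (π / 2))).mulVec x = -x := by
  rw [adRot_diagSU2, show 2 * (π / 2) = π by ring]
  funext a
  fin_cases a <;> simp [chargedRot, Matrix.mulVec, dotProduct, Fin.sum_univ_three, Real.cos_pi, Real.sin_pi, hx]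

omit [NeZero L] in
/-- The constant half-turn colour rotation flips transverse stiff data: `colourRotate (diagSU2 (π/2)) v = −v` when `v_e ⊥ e₀` for all `e`. [folklore] -/
theorem colourRotate_halfTurn_of_transverse {v : Edge 3 L → Fin 3 → ℝ} (hv0 : ∀ e : Edge 3 L, v e 0 = 0) :
    colourRotate L (fun _ => diagSU2 (π / 2)) v = -v := by
  funext e
  exact adRot_halfTurn_mulVec_of_transverse (hv0 e)

/-! ## §3 ★ The averaged kernel does not see the stiff flip over abelian slow data -/

omit [NeZero L] in
/-- ★ **The stiff flip is a gauge transformation.**  Over an abelian diagonal slow datum `u_θ`, for transverse capped stiff data `v`, the constant gauge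
transformation `diagSU2 (π/2)` maps the tube point `orthoTube u_θ v` to `orthoTube u_θ (−v)`. [folklore] -/
theorem gaugeTransform_halfTurn_orthoTube (θ : Fin 3 → ℝ) {v : Edge 3 L → Fin 3 → ℝ} (hv : ∀ e : Edge 3 L, ∑ a, v e a ^ 2 ≤ 1)
    (hv0 : ∀ e : Edge 3 L, v e 0 = 0) :
    gaugeTransform (fun _ : Site 3 L => diagSU2 (π / 2)) (orthoTube L (fun e : Edge 3 1 => diagSU2 (θ e.2)) v) =
      orthoTube L (fun e : Edge 3 1 => diagSU2 (θ e.2)) (-v) := by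
  rw [gaugeTransform_const_orthoTube _ _ hv, gaugeTransform_const_diag, colourRotate_halfTurn_of_transverse hv0]

/-- ★ `K̃_β(U, orthoTube u_θ (−v)) = K̃_β(U, orthoTube u_θ v)`: the gauge-averaged kernel takes the SAME value on the flipped stiff datum (right slot).
[cite: SeilerLNP1982, §3] -/
theorem avgKernel_orthoTube_diag_neg_right (β : ℝ) (U : GaugeConfig 3 L SU2) (θ : Fin 3 → ℝ) {v : Edge 3 L → Fin 3 → ℝ}
    (hv : ∀ e : Edge 3 L, ∑ a, v e a ^ 2 ≤ 1) (hv0 : ∀ e : Edge 3 L, v e 0 = 0) :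
    avgKernel β U (orthoTube L (fun e : Edge 3 1 => diagSU2 (θ e.2)) (-v)) = avgKernel β U (orthoTube L (fun e : Edge 3 1 => diagSU2 (θ e.2)) v) := by
  rw [← gaugeTransform_halfTurn_orthoTube θ hv hv0, avgKernel_gaugeTransform_right]

/-- ★ Left slot: `K̃_β(orthoTube u_θ (−v), V) = K̃_β(orthoTube u_θ v, V)`. [cite: SeilerLNP1982, §3] -/
theorem avgKernel_orthoTube_diag_neg_left (β : ℝ) (θ : Fin 3 → ℝ) {v : Edge 3 L → Fin 3 → ℝ}
    (hv : ∀ e : Edge 3 L, ∑ a, v e a ^ 2 ≤ 1) (hv0 : ∀ e : Edge 3 L, v e 0 = 0) (V : GaugeConfig 3 L SU2) :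
    avgKernel β (orthoTube L (fun e : Edge 3 1 => diagSU2 (θ e.2)) (-v)) V = avgKernel β (orthoTube L (fun e : Edge 3 1 => diagSU2 (θ e.2)) v) V := by
  rw [← gaugeTransform_halfTurn_orthoTube θ hv hv0, avgKernel_gaugeTransform_left]

omit [NeZero L] in
/-- A constant conjugation fixes the vacuum slow datum `u = 1`. [folklore] -/
theorem gaugeTransform_const_oneSite_one (g : SU2) : gaugeTransform (fun _ : Site 3 1 => g) (1 : GaugeConfig 3 1 SU2) = 1 := by
  funext e
  show g * 1 * g⁻¹ = 1
  group

/-- ★ Over the VACUUM slow datum the whole constant gauge group acts on the stiff datum alone: `K̃_β(U, orthoTube 1 (Ad(g) v)) = K̃_β(U, orthoTube 1 v)` for every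
`g ∈ SU(2)` — at the tip of the core the stiff factor of any pointwise model of `K̃_β` must be fully `SO(3)`-twisted. [cite: SeilerLNP1982, §3] -/
theorem avgKernel_orthoTube_one_colourRotate (β : ℝ) (U : GaugeConfig 3 L SU2) (g : SU2) {v : Edge 3 L → Fin 3 → ℝ} (hv : ∀ e : Edge 3 L, ∑ a, v e a ^ 2 ≤ 1) :
    avgKernel β U (orthoTube L 1 (colourRotate L (fun _ => g) v)) = avgKernel β U (orthoTube L 1 v) := by
  have h := gaugeTransform_const_orthoTube (L := L) g 1 hv
  rw [gaugeTransform_const_oneSite_one] at h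
  rw [← h, avgKernel_gaugeTransform_right]

/-! ## §4 ★ The LAB kernel sees the stiff flip at full kinetic cost (exact) -/

omit [NeZero L] in
/-- On the cap, `Σ_a (−v)_e a² = Σ_a v_e a²`. [folklore] -/
theorem sum_sq_neg_apply (v : Edge 3 L → Fin 3 → ℝ) (e : Edge 3 L) : ∑ a, (-v) e a ^ 2 = ∑ a, v e a ^ 2 :=
  Finset.sum_congr rfl fun a _ => by rw [Pi.neg_apply, Pi.neg_apply, neg_sq]

/-- The time coupling across the stiff flip (any slow datum `u`): `Σ_e Re tr((P(v_e)u_k)(P(−v_e)u_k)⁻¹) = Σ_e (2 − 4|v_e|²)`. [cite: SeilerLNP1982, §3] -/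
theorem timeCoupling_orthoTube_neg (u : GaugeConfig 3 1 SU2) {v : Edge 3 L → Fin 3 → ℝ} (hv : ∀ e : Edge 3 L, ∑ a, v e a ^ 2 ≤ 1) :
    timeCoupling su2Rep (orthoTube L u v) (orthoTube L u (-v)) = ∑ e : Edge 3 L, (2 - 4 * ∑ a, v e a ^ 2) := by
  unfold timeCoupling
  refine Finset.sum_congr rfl fun e _ => ?_
  have hneg : ∑ a, (-v) e a ^ 2 ≤ 1 := by rw [sum_sq_neg_apply]; exact hv e
  have ht0 : 0 ≤ 1 - ∑ a, v e a ^ 2 := sub_nonneg.mpr (hv e)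
  rw [su2Rep_apply, re_trace_eq_two_mul_scalarPart, orthoTube_apply, orthoTube_apply, mul_inv_rev, mul_assoc, mul_inv_cancel_left,
    scalarPart_mul, scalarPart_inv, vecPart_inv, scalarPart_chartSU2 (hv e), scalarPart_chartSU2 hneg, vecPart_chartSU2 (hv e),
    vecPart_chartSU2 hneg, sum_sq_neg_apply, Real.mul_self_sqrt ht0, Pi.neg_apply, neg_neg, dotProduct]
  simp only [pow_two]
  ring

/-- ★ **Exact flip factor of the LAB kernel over abelian slow data**: `K_β(orthoTube u_θ v, orthoTube u_θ (−v)) = e^{−4β Σ_e |v_e|²}·K_β(orthoTube u_θ v, orthoTube u_θ v)`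
(the Wilson actions agree by gauge invariance, the time couplings are `Σ_e(2 − 4|v_e|²)` and `2|E|`). [cite: SeilerLNP1982, §3] -/
theorem transferKernel_orthoTube_diag_neg (β : ℝ) (θ : Fin 3 → ℝ) {v : Edge 3 L → Fin 3 → ℝ} (hv : ∀ e : Edge 3 L, ∑ a, v e a ^ 2 ≤ 1)
    (hv0 : ∀ e : Edge 3 L, v e 0 = 0) :
    transferKernel su2Rep β (orthoTube L (fun e : Edge 3 1 => diagSU2 (θ e.2)) v) (orthoTube L (fun e : Edge 3 1 => diagSU2 (θ e.2)) (-v)) =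
      Real.exp (-(4 * β * ∑ e : Edge 3 L, ∑ a, v e a ^ 2)) *
        transferKernel su2Rep β (orthoTube L (fun e : Edge 3 1 => diagSU2 (θ e.2)) v) (orthoTube L (fun e : Edge 3 1 => diagSU2 (θ e.2)) v) := by
  have hS : wilsonAction su2Rep (orthoTube L (fun e : Edge 3 1 => diagSU2 (θ e.2)) (-v)) =
      wilsonAction su2Rep (orthoTube L (fun e : Edge 3 1 => diagSU2 (θ e.2)) v) := by
    rw [← gaugeTransform_halfTurn_orthoTube θ hv hv0, wilsonAction_gaugeTransform]
  unfold transferKernel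
  rw [← Real.exp_add, hS, timeCoupling_orthoTube_neg _ hv, timeCoupling_self, Finset.sum_sub_distrib, Finset.sum_const, Finset.card_univ,
    nsmul_eq_mul, ← Finset.mul_sum]
  congr 1
  ring

/-! ## §5 Tube points near the vacuum: per-link and orbit-distance bounds -/

omit [NeZero L] in
/-- `‖P(x) − 1‖_F ≤ 2|x|` on the closed unit ball (`‖P(x) − 1‖_F² = 4(1 − √(1 − |x|²)) ≤ 4|x|²`). [folklore] -/
theorem frobNorm_chartSU2_sub_one_le_two_sqrt {x : Fin 3 → ℝ} (hx : ∑ a, x a ^ 2 ≤ 1) :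
    frobNorm (((chartSU2 x : SU2) : Matrix (Fin 2) (Fin 2) ℂ) - 1) ≤ 2 * Real.sqrt (∑ a, x a ^ 2) := by
  set t : ℝ := ∑ a, x a ^ 2 with ht
  have ht0 : 0 ≤ t := Finset.sum_nonneg fun a _ => sq_nonneg (x a)
  have h1 : 1 - t ≤ Real.sqrt (1 - t) := by
    have h := Real.sqrt_le_sqrt (show (1 - t) ^ 2 ≤ 1 - t by nlinarith)
    rwa [Real.sqrt_sq (by linarith)] at h
  have hsq : frobNorm (((chartSU2 x : SU2) : Matrix (Fin 2) (Fin 2) ℂ) - 1) ^ 2 ≤ (2 * Real.sqrt t) ^ 2 := by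
    rw [frobNorm_sub_one_sq_eq_scalarPart, scalarPart_chartSU2 hx, mul_pow, Real.sq_sqrt ht0]
    linarith
  exact (pow_le_pow_iff_left₀ (frobNorm_nonneg _) (by positivity) two_ne_zero).mp hsq

omit [NeZero L] in
/-- Per-link distance of a tube point to the vacuum: `‖P(v_e)u_k − 1‖_F ≤ 2|v_e| + ‖u_k − 1‖_F`. [folklore] -/
theorem frobNorm_orthoTube_sub_one_le (u : GaugeConfig 3 1 SU2) {v : Edge 3 L → Fin 3 → ℝ} (hv : ∀ e : Edge 3 L, ∑ a, v e a ^ 2 ≤ 1) (e : Edge 3 L) :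
    frobNorm (((orthoTube L u v e : SU2) : Matrix (Fin 2) (Fin 2) ℂ) - 1) ≤
      2 * Real.sqrt (∑ a, v e a ^ 2) + frobNorm (((u (0, e.2) : SU2) : Matrix (Fin 2) (Fin 2) ℂ) - 1) := by
  rw [orthoTube_apply]
  exact (frobNorm_mul_sub_one_le _ _).trans (add_le_add (frobNorm_chartSU2_sub_one_le_two_sqrt (hv e)) le_rfl)

/-- Orbit distance of a tube point to the vacuum: `orbitDist (orthoTube u v) ≤ Σ_e (2|v_e| + ‖u_{k(e)} − 1‖_F)` (gauge transformation `1`). [folklore] -/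
theorem orbitDist_orthoTube_le (u : GaugeConfig 3 1 SU2) {v : Edge 3 L → Fin 3 → ℝ} (hv : ∀ e : Edge 3 L, ∑ a, v e a ^ 2 ≤ 1) :
    orbitDist (orthoTube L u v) ≤ ∑ e : Edge 3 L, (2 * Real.sqrt (∑ a, v e a ^ 2) + frobNorm (((u (0, e.2) : SU2) : Matrix (Fin 2) (Fin 2) ℂ) - 1)) := by
  refine (orbitDist_le 1 _).trans ?_
  unfold gaugeDist
  refine Finset.sum_le_sum fun e _ => ?_
  have h1 : gaugeTransform (1 : Site 3 L → SU2) (orthoTube L u v) e = orthoTube L u v e := by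
    simp only [gaugeTransform, Pi.one_apply, one_mul, inv_one, mul_one]
  rw [h1]
  exact frobNorm_orthoTube_sub_one_le u hv e

/-- The capped balanced set is symmetric. [folklore] -/
theorem neg_mem_capBalancedSet {v : Edge 3 L → Fin 3 → ℝ} (hv : v ∈ capBalancedSet L) : -v ∈ capBalancedSet L := by
  refine ⟨fun k a => ?_, fun e => by rw [sum_sq_neg_apply]; exact hv.2 e⟩
  have h := hv.1 k a
  simp only [Pi.neg_apply, Finset.sum_neg_distrib, neg_eq_zero]
  exact h


/-- ★ **The antipodal two-link stiff witness.**  For `2 ≤ L` and `0 < a ≤ 1/2`: the stiff datum `v^{(a)}` with `v_{(0,0)} = a·e₁`, `v_{(x₁,0)} = −a·e₁`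
(`x₁ = (1,1,1) ≠ 0`) and all other links `0` is capped and balanced, TRANSVERSE (`v_e ⊥ e₀`), with `|v_e|² ≤ a²` per link, `Σ_e |v_e|² = 2a²` and
`Σ_e |v_e| = 2a`. [folklore] -/
theorem exists_stiff_witness (hL : 2 ≤ L) {a : ℝ} (ha0 : 0 < a) (ha : a ≤ 1 / 2) :
    ∃ v : Edge 3 L → Fin 3 → ℝ, v ∈ capBalancedSet L ∧ (∀ e, v e 0 = 0) ∧ (∀ e, ∑ b, v e b ^ 2 ≤ a ^ 2) ∧
      ∑ e, ∑ b, v e b ^ 2 = 2 * a ^ 2 ∧ ∑ e, Real.sqrt (∑ b, v e b ^ 2) = 2 * a := by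
  haveI : Fact (1 < L) := ⟨hL⟩
  -- two distinct sites `0` and `x₁ = (1,1,1)`
  set x₁ : Site 3 L := fun _ => 1 with hx₁
  have hx : (0 : Site 3 L) ≠ x₁ := fun h => zero_ne_one (congr_fun h 0)
  have hx' : x₁ ≠ 0 := fun h => hx h.symm
  -- the site profile `σ = δ_0 − δ_{x₁}` (sums to zero) and the edge profile `c = σ ⊗ δ_{k=0}`
  set σ : Site 3 L → ℝ := fun x => (if x = 0 then 1 else 0) - (if x = x₁ then 1 else 0) with hσ
  have hσ0 : σ 0 = 1 := by simp [hσ, hx]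
  have hσ1 : σ x₁ = -1 := by simp [hσ, hx']
  have hσx : ∀ x, x ≠ 0 → x ≠ x₁ → σ x = 0 := fun x h0 h1 => by simp [hσ, h0, h1]
  have hind : ∀ x, σ x ^ 2 = (if x = 0 then 1 else 0) + (if x = x₁ then 1 else 0) ∧
      |σ x| = (if x = 0 then 1 else 0) + (if x = x₁ then 1 else 0) := by
    intro x
    by_cases h0 : x = 0
    · subst h0; simp [hσ0, hx]
    · by_cases h1 : x = x₁
      · subst h1; simp [hσ1, hx']
      · simp [hσx x h0 h1, h0, h1]
  have hσsum : ∑ x, σ x = 0 := by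
    simp only [hσ, Finset.sum_sub_distrib, Finset.sum_ite_eq', Finset.mem_univ, if_true, sub_self]
  have hσ2 : ∑ x, σ x ^ 2 = 2 := by
    simp only [fun x => (hind x).1, Finset.sum_add_distrib, Finset.sum_ite_eq', Finset.mem_univ, if_true]; norm_num
  have hσa : ∑ x, |σ x| = 2 := by
    simp only [fun x => (hind x).2, Finset.sum_add_distrib, Finset.sum_ite_eq', Finset.mem_univ, if_true]; norm_num
  have hσle : ∀ x, σ x ^ 2 ≤ 1 := by
    intro x
    by_cases h0 : x = 0
    · subst h0; simp [hσ0]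
    · by_cases h1 : x = x₁
      · subst h1; simp [hσ1]
      · simp [hσx x h0 h1]
  set c : Edge 3 L → ℝ := fun e => if e.2 = 0 then σ e.1 else 0 with hc
  have hcle : ∀ e, c e ^ 2 ≤ 1 := fun e => by
    by_cases h : e.2 = 0
    · simp only [hc, h, if_true]; exact hσle e.1
    · simp [hc, h]
  have hc2 : ∑ e, c e ^ 2 = 2 := by
    rw [Fintype.sum_prod_type]
    simp only [hc, Fin.sum_univ_three, Fin.isValue, if_true, show (1 : Fin 3) ≠ 0 by decide, show (2 : Fin 3) ≠ 0 by decide, if_false]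
    simpa using hσ2
  have hca : ∑ e, |c e| = 2 := by
    rw [Fintype.sum_prod_type]
    simp only [hc, Fin.sum_univ_three, Fin.isValue, if_true, show (1 : Fin 3) ≠ 0 by decide, show (2 : Fin 3) ≠ 0 by decide, if_false]
    simpa using hσa
  -- the colour vector `w = a e₁`
  set w : Fin 3 → ℝ := Pi.single 1 a with hw
  have hw0 : w 0 = 0 := by simp [hw]
  have hw2 : ∑ b, w b ^ 2 = a ^ 2 := by simp [hw, Fin.sum_univ_three]
  have hve : ∀ e, ∑ b, (c e * w b) ^ 2 = c e ^ 2 * a ^ 2 := fun e => by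
    simp only [mul_pow]; rw [← Finset.mul_sum, hw2]
  refine ⟨fun e b => c e * w b, ⟨fun k b => ?_, fun e => ?_⟩, fun e => by simp [hw0], fun e => ?_, ?_, ?_⟩
  · -- balanced
    rw [← Finset.sum_mul]
    have : ∑ x : Site 3 L, c (x, k) = 0 := by
      by_cases hk : k = 0
      · simp only [hc, hk, if_true]; exact hσsum
      · simp [hc, hk]
    rw [this, zero_mul]
  · -- cap
    rw [hve]
    have ha2 : a ^ 2 ≤ 1 / 4 := by nlinarith
    nlinarith [hcle e, sq_nonneg a]
  · rw [hve]; nlinarith [hcle e, sq_nonneg a]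
  · simp only [hve]; rw [← Finset.sum_mul, hc2]
  · simp only [hve]
    have : ∀ e, Real.sqrt (c e ^ 2 * a ^ 2) = |c e| * a := fun e => by
      rw [show c e ^ 2 * a ^ 2 = (c e * a) ^ 2 by ring, Real.sqrt_sq_eq_abs, abs_mul, abs_of_pos ha0]
    simp only [this]; rw [← Finset.sum_mul, hca]

/-- ★★ **Stiff flip pairs inside the core.**  For `2 ≤ L`, `s ≥ 0`, any `β` and any stiff amplitude `0 < a ≤ β^{−s}/16` (`powScale s β = max(β,1)^{−s}`):
over the abelian diagonal slow datum `u_θ = (diagSU2 θ)³`, `θ = β^{−s}/(8|E|)`, the tube points `U = orthoTube u_θ v^{(a)}` and `V = orthoTube u_θ (−v^{(a)})`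
(antipodal two-link transverse stiff data of total kinetic size `Σ_e|v_e|² = 2a²`) are BOTH in the core — slow datum, every link and the orbit distance
within `β^{−s}` of the vacuum — `V` is a CONSTANT gauge transform of `U`, the gauge-averaged kernel takes its diagonal value on the pair,
`K̃_β(U,V) = K̃_β(U,U)`, and the LAB kernel pays exactly `K_β(U,V) = e^{−8βa²}·K_β(U,U)`. [folklore] -/
theorem exists_stiff_flip_pair (hL : 2 ≤ L) {s : ℝ} (hs0 : 0 ≤ s) (β : ℝ) {a : ℝ} (ha0 : 0 < a) (ha : a ≤ powScale s β / 16) :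
    ∃ (u : GaugeConfig 3 1 SU2) (v : Edge 3 L → Fin 3 → ℝ),
      v ∈ capBalancedSet L ∧ -v ∈ capBalancedSet L ∧ (∀ e, v e 0 = 0) ∧
      ∑ e, ∑ b, v e b ^ 2 = 2 * a ^ 2 ∧ ∑ e, ∑ b, (-v) e b ^ 2 = 2 * a ^ 2 ∧
      (∃ θ : Fin 3 → ℝ, u = fun e : Edge 3 1 => diagSU2 (θ e.2)) ∧
      (∀ e, frobNorm (((u e : SU2) : Matrix (Fin 2) (Fin 2) ℂ) - 1) < powScale s β) ∧
      (∀ e, frobNorm (((orthoTube L u v e : SU2) : Matrix (Fin 2) (Fin 2) ℂ) - 1) < powScale s β) ∧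
      (∀ e, frobNorm (((orthoTube L u (-v) e : SU2) : Matrix (Fin 2) (Fin 2) ℂ) - 1) < powScale s β) ∧
      orbitDist (orthoTube L u v) < powScale s β ∧ orbitDist (orthoTube L u (-v)) < powScale s β ∧
      (∃ g : SU2, orthoTube L u (-v) = gaugeTransform (fun _ : Site 3 L => g) (orthoTube L u v)) ∧
      avgKernel β (orthoTube L u v) (orthoTube L u (-v)) = avgKernel β (orthoTube L u v) (orthoTube L u v) ∧
      transferKernel su2Rep β (orthoTube L u v) (orthoTube L u (-v)) =
        Real.exp (-(8 * β * a ^ 2)) * transferKernel su2Rep β (orthoTube L u v) (orthoTube L u v) := by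
  set δ : ℝ := powScale s β with hδdef
  have hδ0 : 0 < δ := powScale_pos s β
  have hδ1 : δ ≤ 1 := powScale_le_one hs0 β
  have ha2 : a ≤ 1 / 2 := by linarith
  obtain ⟨v, hv, hv0, hve, hvv, hvs⟩ := exists_stiff_witness (L := L) hL ha0 ha2
  have hv1 : ∀ e : Edge 3 L, ∑ b, v e b ^ 2 ≤ 1 := fun e => sum_sq_le_one_of_cap L hv.2 e
  have hnv : -v ∈ capBalancedSet L := neg_mem_capBalancedSet hv
  have hnv1 : ∀ e : Edge 3 L, ∑ b, (-v) e b ^ 2 ≤ 1 := fun e => sum_sq_le_one_of_cap L hnv.2 e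
  -- the slow angle
  set N : ℝ := (Fintype.card (Edge 3 L) : ℝ) with hN
  have hN1 : (1 : ℝ) ≤ N := by rw [hN]; exact_mod_cast Fintype.card_pos
  set θ : ℝ := δ / (8 * N) with hθ
  have hθ0 : 0 < θ := by positivity
  have hs2 : Real.sqrt 2 < 2 := (Real.sqrt_lt' (by norm_num)).mpr (by norm_num)
  have hs20 : 0 < Real.sqrt 2 := Real.sqrt_pos.mpr (by norm_num)
  have huθ : frobNorm (((diagSU2 θ : SU2) : Matrix (Fin 2) (Fin 2) ℂ) - 1) ≤ Real.sqrt 2 * θ := by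
    have h := frobNorm_diagSU2_sub_one_le θ; rwa [abs_of_pos hθ0] at h
  have hNθ : N * (Real.sqrt 2 * θ) = Real.sqrt 2 / 8 * δ := by rw [hθ]; field_simp
  have hθδ : Real.sqrt 2 * θ ≤ Real.sqrt 2 / 8 * δ := by
    rw [← hNθ]; exact le_mul_of_one_le_left (by positivity) hN1
  -- per-link stiff sizes
  have hsq : ∀ e, Real.sqrt (∑ b, v e b ^ 2) ≤ a := fun e => by
    rw [← Real.sqrt_sq ha0.le]; exact Real.sqrt_le_sqrt (hve e)
  have hsqn : ∀ e, Real.sqrt (∑ b, (-v) e b ^ 2) ≤ a := fun e => by rw [sum_sq_neg_apply]; exact hsq e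
  set u : GaugeConfig 3 1 SU2 := fun e => diagSU2 ((fun _ : Fin 3 => θ) e.2) with hu
  have hue : ∀ e : Edge 3 L, frobNorm (((u (0, e.2) : SU2) : Matrix (Fin 2) (Fin 2) ℂ) - 1) ≤ Real.sqrt 2 * θ := fun e => huθ
  -- per-link bound for a tube point with stiff sizes `≤ a`
  have hlink : ∀ w : Edge 3 L → Fin 3 → ℝ, (∀ e, ∑ b, w e b ^ 2 ≤ 1) → (∀ e, Real.sqrt (∑ b, w e b ^ 2) ≤ a) →
      ∀ e, frobNorm (((orthoTube L u w e : SU2) : Matrix (Fin 2) (Fin 2) ℂ) - 1) < δ := by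
    intro w hw1 hwa e
    have h := frobNorm_orthoTube_sub_one_le u hw1 e
    have h1 := hwa e
    have h2 := hue e
    nlinarith
  -- orbit bound for a tube point with `Σ_e |w_e| = 2a`
  have horb : ∀ w : Edge 3 L → Fin 3 → ℝ, (∀ e, ∑ b, w e b ^ 2 ≤ 1) → ∑ e, Real.sqrt (∑ b, w e b ^ 2) = 2 * a →
      orbitDist (orthoTube L u w) < δ := by
    intro w hw1 hws
    refine (orbitDist_orthoTube_le u hw1).trans_lt ?_
    rw [Finset.sum_add_distrib, ← Finset.mul_sum, hws]
    have h1 : ∑ e : Edge 3 L, frobNorm (((u (0, e.2) : SU2) : Matrix (Fin 2) (Fin 2) ℂ) - 1) ≤ N * (Real.sqrt 2 * θ) := by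
      have h := Finset.sum_le_sum fun e (_ : e ∈ (Finset.univ : Finset (Edge 3 L))) => hue e
      rwa [Finset.sum_const, Finset.card_univ, nsmul_eq_mul] at h
    rw [hNθ] at h1
    nlinarith
  have hvs' : ∑ e, Real.sqrt (∑ b, (-v) e b ^ 2) = 2 * a := by
    rw [← hvs]; exact Finset.sum_congr rfl fun e _ => by rw [sum_sq_neg_apply]
  have hfix : gaugeTransform (fun _ : Site 3 1 => diagSU2 (π / 2)) u = u := gaugeTransform_const_diag (π / 2) fun _ => θ
  refine ⟨u, v, hv, hnv, hv0, hvv, by rw [← hvv]; exact Finset.sum_congr rfl fun e _ => sum_sq_neg_apply v e, ⟨fun _ => θ, rfl⟩,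
    fun _ => huθ.trans_lt (by nlinarith), hlink v hv1 hsq, hlink (-v) hnv1 hsqn, horb v hv1 hvs, horb (-v) hnv1 hvs',
    ⟨diagSU2 (π / 2), (gaugeTransform_halfTurn_orthoTube (fun _ => θ) hv1 hv0).symm⟩,
    avgKernel_orthoTube_diag_neg_right β _ (fun _ => θ) hv1 hv0, ?_⟩
  rw [transferKernel_orthoTube_diag_neg β (fun _ => θ) hv1 hv0, hvv]
  congr 2
  ring


end Summit.QuantumFields.YangMills.Theorems.TwistedTraceScaling.Negative.R33

end
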